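import Mathlib
import HarnessLib

/-!
# Analytic sets carry no mass invisible to compact sets (stub T1 of crux `RemovableLimit`)

Route `SAWWeldingIdentification`, crux stmt-CriticalPhenomena-4503 `RemovableLimit`, line
`registered` (skeleton v3), stub `stub_measure_eq_zero_of_analyticSet`.

On a Hausdorff space whose open sets are measurable, a finite measure vanishing on every compact
subset of an analytic set `s` (`MeasureTheory.AnalyticSet`) vanishes on `s`. Special case of
Choquet capacitability / Lusin's universal measurability of analytic sets (Kechris, *Classical
Descriptive Set Theory*, Thm 30.13, Thm 29.7).

The proof is the classical "box" argument on the Baire space `ℕ → ℕ`: writing `s = range f` with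
`f` continuous, if `μ s > r > 0` one chooses `k : ℕ → ℕ` recursively so that every box
`{t | ∀ i < n, t i ≤ k i}` has image of measure `> r` (continuity of the outer measure along
increasing unions); the compact set `K = {t | ∀ i, t i ≤ k i}` then satisfies
`⋂ n, closure (f '' box n) ⊆ f '' K` (tube lemma + Hausdorff separation of the compact `f '' K`
from a point), so continuity from above along the closed sets `closure (f '' box n)` forces
`μ (f '' K) ≥ r > 0`, contradicting the hypothesis on compact subsets.
-/

open MeasureTheory Filter Set Topology

namespace Summit.CriticalPhenomena.SAWScalingLimit.Theorems.RemovableLimit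

/-- Every point of an open subset `W` of the Baire space has a cylinder around it inside `W`.
[folklore] -/
theorem exists_cylinder_subset_of_isOpen {W : Set (ℕ → ℕ)} (hW : IsOpen W) {x : ℕ → ℕ}
    (hx : x ∈ W) : ∃ n, PiNat.cylinder x n ⊆ W := by
  obtain ⟨v, ⟨y, n, rfl⟩, hxv, hvW⟩ :=
    (PiNat.isTopologicalBasis_cylinders fun _ : ℕ => ℕ).exists_subset_of_mem_open hx hW
  refine ⟨n, ?_⟩
  rw [PiNat.mem_cylinder_iff_eq.1 hxv]
  exact hvW

/-- **Tube lemma for boxes of the Baire space.** If the compact box `{t | ∀ i, t i ≤ k i}` lies in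
an open set `W`, then already some finite-stage box `{t | ∀ i < N, t i ≤ k i}` lies in `W`.
[folklore] -/
theorem exists_box_subset_of_isOpen (k : ℕ → ℕ) {W : Set (ℕ → ℕ)} (hW : IsOpen W)
    (hKW : {t : ℕ → ℕ | ∀ i, t i ≤ k i} ⊆ W) :
    ∃ N, {t : ℕ → ℕ | ∀ i < N, t i ≤ k i} ⊆ W := by
  have hK : IsCompact {t : ℕ → ℕ | ∀ i, t i ≤ k i} :=
    isCompact_pi_infinite fun i => (Set.finite_Iic (k i)).isCompact
  have hcyl : ∀ x ∈ W, ∃ n, PiNat.cylinder x n ⊆ W := fun x hx =>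
    exists_cylinder_subset_of_isOpen hW hx
  choose! n hn using hcyl
  obtain ⟨T, hTK, hKT⟩ := hK.elim_nhds_subcover (fun x => PiNat.cylinder x (n x)) fun x _ =>
    (PiNat.isOpen_cylinder _ x (n x)).mem_nhds (PiNat.self_mem_cylinder x (n x))
  refine ⟨T.sup n, fun t ht => ?_⟩
  have ht' : (fun i => min (t i) (k i)) ∈ {t : ℕ → ℕ | ∀ i, t i ≤ k i} := fun i => min_le_right _ _
  obtain ⟨x, hxT, hx⟩ := Set.mem_iUnion₂.1 (hKT ht')
  have hxW : PiNat.cylinder x (n x) ⊆ W := hn x (hKW (hTK x hxT))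
  refine hxW (PiNat.mem_cylinder_iff.2 fun i hi => ?_)
  have hiN : i < T.sup n := hi.trans_le (Finset.le_sup hxT)
  have hmin : min (t i) (k i) = x i := PiNat.mem_cylinder_iff.1 hx i hi
  rwa [min_eq_left (ht i hiN)] at hmin

/-- **The closures of the images of the boxes shrink to the image of the compact box.** For a
continuous `f` on the Baire space with Hausdorff target,
`⋂ n, closure (f '' {t | ∀ i < n, t i ≤ k i}) ⊆ f '' {t | ∀ i, t i ≤ k i}`. [folklore] -/
theorem iInter_closure_image_box_subset {X : Type*} [TopologicalSpace X] [T2Space X]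
    {f : (ℕ → ℕ) → X} (hf : Continuous f) (k : ℕ → ℕ) :
    ⋂ n, closure (f '' {t : ℕ → ℕ | ∀ i < n, t i ≤ k i}) ⊆ f '' {t : ℕ → ℕ | ∀ i, t i ≤ k i} := by
  intro x hx
  by_contra hxK
  have hKc : IsCompact (f '' {t : ℕ → ℕ | ∀ i, t i ≤ k i}) :=
    (isCompact_pi_infinite fun i => (Set.finite_Iic (k i)).isCompact).image hf
  obtain ⟨U, V, hU, hV, hxU, hKV, hUV⟩ :=
    SeparatedNhds.of_isCompact_isCompact isCompact_singleton hKc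
      (Set.disjoint_singleton_left.2 hxK)
  obtain ⟨N, hN⟩ := exists_box_subset_of_isOpen k (hV.preimage hf) fun t ht =>
    hKV (Set.mem_image_of_mem f ht)
  have hxN : x ∈ closure (f '' {t : ℕ → ℕ | ∀ i < N, t i ≤ k i}) := Set.mem_iInter.1 hx N
  have hsub : closure (f '' {t : ℕ → ℕ | ∀ i < N, t i ≤ k i}) ⊆ closure V :=
    closure_mono (Set.image_subset_iff.2 hN)
  exact Set.disjoint_left.1 (hUV.closure_right hU) (Set.singleton_subset_iff.1 hxU) (hsub hxN)

/-- **One-step extension of a heavy box.** If the image of the box `{t | ∀ i < n, t i ≤ k i}`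
has (outer) measure `> r`, then so does the image of `{t | ∀ i < n + 1, t i ≤ k' i}` for
`k' = update k n j` with `j` large: the boxes cut at height `j` in coordinate `n` increase to the
full box, and the outer measure is continuous along increasing sequences of arbitrary sets.
[folklore] -/
theorem exists_measure_image_box_succ_gt {X : Type*} [MeasurableSpace X] (μ : Measure X)
    (f : (ℕ → ℕ) → X) {r : ENNReal} (n : ℕ) (k : ℕ → ℕ)
    (hk : r < μ (f '' {t : ℕ → ℕ | ∀ i < n, t i ≤ k i})) :
    ∃ j : ℕ, r < μ (f '' {t : ℕ → ℕ | ∀ i < n + 1, t i ≤ Function.update k n j i}) := by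
  have hmono : Monotone fun j : ℕ => f '' {t : ℕ → ℕ | (∀ i < n, t i ≤ k i) ∧ t n ≤ j} := by
    intro j j' hjj'
    exact Set.image_mono fun t ht => ⟨ht.1, ht.2.trans hjj'⟩
  have hU : ⋃ j : ℕ, f '' {t : ℕ → ℕ | (∀ i < n, t i ≤ k i) ∧ t n ≤ j} =
      f '' {t : ℕ → ℕ | ∀ i < n, t i ≤ k i} := by
    rw [← Set.image_iUnion]
    congr 1
    ext t
    simp only [Set.mem_iUnion, Set.mem_setOf_eq]
    exact ⟨fun ⟨_, h⟩ => h.1, fun h => ⟨t n, h, le_rfl⟩⟩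
  rw [← hU, hmono.measure_iUnion] at hk
  obtain ⟨j, hj⟩ := lt_iSup_iff.1 hk
  refine ⟨j, hj.trans_le (measure_mono (Set.image_mono fun t ht => ?_))⟩
  intro i hi
  rcases (Nat.lt_succ_iff.1 hi).lt_or_eq with hlt | rfl
  · rw [Function.update_of_ne hlt.ne]
    exact ht.1 i hlt
  · rw [Function.update_self]
    exact ht.2

/-- **Recursive choice of heavy boxes.** If `range f` has (outer) measure `> r`, there is
`k : ℕ → ℕ` all of whose boxes `{t | ∀ i < n, t i ≤ k i}` have image of measure `> r`.
[folklore] -/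
theorem exists_seq_measure_image_box_gt {X : Type*} [MeasurableSpace X] (μ : Measure X)
    (f : (ℕ → ℕ) → X) {r : ENNReal} (hr : r < μ (range f)) :
    ∃ k : ℕ → ℕ, ∀ n, r < μ (f '' {t : ℕ → ℕ | ∀ i < n, t i ≤ k i}) := by
  choose! J hJ using exists_measure_image_box_succ_gt μ f (r := r)
  obtain ⟨F, hF0, hFs⟩ : ∃ F : ℕ → ℕ → ℕ, F 0 = (fun _ => 0) ∧
      ∀ m, F (m + 1) = Function.update (F m) m (J m (F m)) :=
    ⟨fun n => Nat.rec (motive := fun _ => ℕ → ℕ) (fun _ => 0)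
      (fun m km => Function.update km m (J m km)) n, rfl, fun _ => rfl⟩
  have hgood : ∀ n, r < μ (f '' {t : ℕ → ℕ | ∀ i < n, t i ≤ F n i}) := by
    intro n
    induction n with
    | zero =>
      have huniv : {t : ℕ → ℕ | ∀ i < 0, t i ≤ F 0 i} = univ := by
        ext t
        simp
      rwa [huniv, Set.image_univ]
    | succ m ih =>
      rw [hFs]
      exact hJ m (F m) ih
  have hcoh : ∀ n, ∀ i < n, F n i = F (i + 1) i := by
    intro n
    induction n with
    | zero => exact fun i hi => absurd hi (Nat.not_lt_zero i)
    | succ m ih =>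
      intro i hi
      rcases (Nat.lt_succ_iff.1 hi).lt_or_eq with hlt | rfl
      · rw [hFs, Function.update_of_ne hlt.ne]
        exact ih i hlt
      · rfl
  refine ⟨fun i => F (i + 1) i, fun n => ?_⟩
  have hset : {t : ℕ → ℕ | ∀ i < n, t i ≤ F (i + 1) i} = {t : ℕ → ℕ | ∀ i < n, t i ≤ F n i} := by
    ext t
    simp only [Set.mem_setOf_eq]
    exact forall₂_congr fun i hi => by rw [hcoh n i hi]
  rw [hset]
  exact hgood n

/-- **Continuous images of the Baire space carry no mass invisible to compact sets.** On a
Hausdorff space whose open sets are measurable, a finite measure vanishing on all compact subsets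
of `range f`, `f : (ℕ → ℕ) → X` continuous, vanishes on `range f`. [folklore] -/
theorem measure_range_eq_zero_of_forall_isCompact {X : Type*} [TopologicalSpace X] [T2Space X]
    [MeasurableSpace X] [OpensMeasurableSpace X] (μ : Measure X) [IsFiniteMeasure μ]
    {f : (ℕ → ℕ) → X} (hf : Continuous f) (h : ∀ K ⊆ range f, IsCompact K → μ K = 0) :
    μ (range f) = 0 := by
  by_contra hne
  obtain ⟨r, hr0, hr⟩ := exists_between (pos_iff_ne_zero.2 hne)
  obtain ⟨k, hk⟩ := exists_seq_measure_image_box_gt μ f hr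
  have hKc : IsCompact {t : ℕ → ℕ | ∀ i, t i ≤ k i} :=
    isCompact_pi_infinite fun i => (Set.finite_Iic (k i)).isCompact
  have hfK : μ (f '' {t : ℕ → ℕ | ∀ i, t i ≤ k i}) = 0 :=
    h _ (Set.image_subset_range _ _) (hKc.image hf)
  have hanti : Antitone fun n : ℕ => closure (f '' {t : ℕ → ℕ | ∀ i < n, t i ≤ k i}) := by
    intro m n hmn
    exact closure_mono (Set.image_mono fun t ht i hi => ht i (hi.trans_le hmn))
  have hinter : μ (⋂ n : ℕ, closure (f '' {t : ℕ → ℕ | ∀ i < n, t i ≤ k i})) =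
      ⨅ n : ℕ, μ (closure (f '' {t : ℕ → ℕ | ∀ i < n, t i ≤ k i})) :=
    hanti.measure_iInter (fun _ => isClosed_closure.nullMeasurableSet) ⟨0, measure_ne_top μ _⟩
  have hle : r ≤ μ (⋂ n : ℕ, closure (f '' {t : ℕ → ℕ | ∀ i < n, t i ≤ k i})) := by
    rw [hinter]
    exact le_iInf fun n => (hk n).le.trans (measure_mono subset_closure)
  have hzero : μ (⋂ n : ℕ, closure (f '' {t : ℕ → ℕ | ∀ i < n, t i ≤ k i})) = 0 :=
    measure_mono_null (iInter_closure_image_box_subset hf k) hfK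
  rw [hzero, nonpos_iff_eq_zero] at hle
  exact hr0.ne' hle

/-- **Analytic sets carry no mass invisible to compact sets.** On a Hausdorff topological space
whose open sets are measurable, a finite measure `μ` that gives measure zero to every compact
subset of an analytic set `s` gives (outer) measure zero to `s`. [folklore] -/
theorem stub_measure_eq_zero_of_analyticSet {X : Type*} [TopologicalSpace X] [T2Space X]
    [MeasurableSpace X] [OpensMeasurableSpace X] (μ : Measure X) [IsFiniteMeasure μ] (s : Set X)
    (hs : AnalyticSet s) (h : ∀ K ⊆ s, IsCompact K → μ K = 0) : μ s = 0 := by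
  rw [AnalyticSet] at hs
  rcases hs with rfl | ⟨f, hf, rfl⟩
  · exact measure_empty
  · exact measure_range_eq_zero_of_forall_isCompact μ hf h

end Summit.CriticalPhenomena.SAWScalingLimit.Theorems.RemovableLimit
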